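import Summits.QuantumFields.YangMills.Theorems.UnitScaleTiltProp7CoerciveSlotsOfInverseBound
import Summits.QuantumFields.YangMills.Theorems.UnitScaleTiltProp7DeltaEtaAlmostPositive
import Summits.QuantumFields.YangMills.Theorems.UnitScaleTiltProp7SectET3WilsonHessianT3RealityRows
import HarnessLib

/-!
# Route `UnitScaleTilt`, crux K1 «MinimiserStabilityRegPr» (stmt-QuantumFields-19200) — route-R E′ (A′)-on-Σ, ★p1 g17 WORDS 20∕21 («the lane is COMB end-to-end … w4 g8: re-instantiate
# `coercive_…_of_normG₀` at `laplaceAc`»): **THE COERCIVITY ROW OF `Δ_a(U₀) = Δ^η(U₀) + D Rr D* + Qc† aQ Qc` FROM THE `norm_G₀` ROW ALONE, FOR ANY PROJECTOR SLOT `Rr` AND ANY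
# AVERAGING SLOT `Qc`** — letter-independent: the comb letters of record (`Rc W := projR (covLapSite W) (Q′combL2 W)`, `Qkc := η•QL2c`, `laplaceAc`) instantiate it by their `rfl` bridge

Cell `ym3-torus`, width seat `ym-ust-19200-w4` (gen 8).  Composition of ★p1 g17's generic-slot reading ✓`Prop7CoerciveSlotsOfInverseBound.coercive_slots_of_almostPos_of_inverse_bound`
(p688866) with this seat's T2 ✓`Prop7DeltaEtaAlmostPositive.almostPos_DeltaEtaSlot_of_regPr` (p689838; the almost-positivity of `Δ^η` is SLOT-ONLY — no `Q`, no `R` — so it serves the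
symmetric pair, print's comb pair, or any other) and the lane's Hermitian row ✓`Prop7SectET3WilsonHessian.DeltaEta_isSymmetric`.  THEOREMS ONLY (0 `def`, 0 `sorry`);
`--supports stmt-QuantumFields-19200`, count-neutral.  YM₃ on T³ is a ladder rung (R3), not the Clay problem; the `norm_G₀` right-inverse row is a HYPOTHESIS ([Balaban1985BackgroundPropagators]
Thm 3.3's `L²` clause, N06); nothing here claims it, HESS at `IsCritR2`, `hcoS`∕`hcoW`, E′, EX, the crux, d = 4 or the mass gap.

WHAT IS PROVED (ns `…Theorems.Prop7CoerciveSlotsOfNormG0`; `Rr` any symmetric idempotent map of the gauge-parameter space, `Qc` any linear map to a finite-dimensional Hilbert space,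
`aQ ≥ 0` real, `D := DL2 U₀`, `D* := DstarL2 U₀`, Hessian slot `DeltaEtaSlot F n K c₀ U₀`):
★★★ `coercive_slots_DeltaEta_of_normG₀` — on `RegPr F n K ε₀ U₀` (`0 ≤ ε₀`), a right inverse `G₀` of `laplaceAK (Δ^η U₀) D Rr D* Qc Qc† aQ` with `‖G₀ f‖ ≤ B₀‖f‖` and the window
`1029·ε₀·B₀ < 1` give `B₀⁻¹‖y‖² ≤ re⟪y, laplaceAK … y⟫` for all `y`; ★★ `pos_slots_DeltaEta_of_normG₀` (`x ≠ 0 → 0 < re⟪x, Δ_a x⟫`, the EX display's `hPosΔ` shape at slot `Δ^η` for any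
pair); ★ `coercive_slots_DeltaEta_of_normG₀_projR` (the projector slot written as lit's `projR Δs Q′` — print's `R(U₀)` for ANY `Q′`, e.g. the comb `Q′combL2` of WORD 21 (c) —
symmetric∕idempotent by lit ✓`projR_isSymmetric`∕`projR_projR`, so only `Qc`, `aQ`, `G₀` remain as data).  USE: px6 g5's `laplaceAc … = laplaceAK (Δx W) (DL2 W) (Rc W) (DstarL2 W) (Qkc W)
(Qkc W)† a` bridge (`rfl`) ▸ `coercive_slots_DeltaEta_of_normG₀_projR`.  HONEST SCOPE: composition; constants crude (`1029`); rung R3, not Clay; YM gap NOT proved.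

References: T. Bałaban, CMP 99 (1985) 389–434 [Balaban1985BackgroundPropagators] ((3.10) p.392, (3.21)–(3.27) pp.394–395, Thm 3.3 p.399, Thm 3.11 p.416); CMP 102 (1985) 277–309
[Balaban1985Variational] ((14) p.280, (141)–(142) p.299).
-/

set_option autoImplicit false

noncomputable section

open scoped InnerProductSpace ComplexConjugate BigOperators

namespace Summit.QuantumFields.YangMills.Theorems.Prop7CoerciveSlotsOfNormG0

open Literature.MathematicalPhysics.QuantumFieldTheory.Balaban1983to89
open Literature.MathematicalPhysics.QuantumFieldTheory.Balaban1983to89.T3ContinuumYM3Torus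
open Literature.MathematicalPhysics.QuantumFieldTheory.Balaban1983to89.T3PrintedRegularMinimiser (RegPr)
open B11Eq103H1Complex (SiteL2K BondL2K laplaceAK projR projR_isSymmetric projR_projR)
open Summit.QuantumFields.YangMills.Theorems.Prop7SectET3Transport (periodsT3)
open Summit.QuantumFields.YangMills.Theorems.Prop7SectET3HilbertLetters (W₂ DL2 DstarL2)
open Summit.QuantumFields.YangMills.Theorems.Prop7SectET3WilsonHessian (DeltaEtaSlot DeltaEta_isSymmetric)
open Summit.QuantumFields.YangMills.Theorems.Prop7CoerciveSlotsOfInverseBound (coercive_slots_of_almostPos_of_inverse_bound)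
open Summit.QuantumFields.YangMills.Theorems.Prop7DeltaEtaAlmostPositive (almostPos_DeltaEtaSlot_of_regPr)

variable (F : T3Family) (n K : ℕ) (c₀ : ℝ) [Fact (0 < c₀)]
  {CW : Type*} [NormedAddCommGroup CW] [InnerProductSpace ℂ CW] [FiniteDimensional ℂ CW]

/-- ★★★ **(COERC) FROM `norm_G₀` ALONE, ANY PROJECTOR∕AVERAGING SLOTS.**  On `RegPr F n K ε₀ U₀` (`0 ≤ ε₀`): for any symmetric idempotent `Rr`, any `Qc`, `aQ ≥ 0`, a right inverse
`G₀` of `Δ_a(U₀) = laplaceAK (Δ^η U₀) (D_{U₀}) Rr (D*_{U₀}) Qc Qc† aQ` with `‖G₀ f‖ ≤ B₀‖f‖` and `1029·ε₀·B₀ < 1` give `B₀⁻¹·‖y‖² ≤ re⟪y, Δ_a(U₀) y⟫` for every `y` —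
[Balaban1985BackgroundPropagators] Thm 3.11 for `Δ_a` from Thm 3.3's `L²` bound, the almost-positivity of `Δ^η` ((3.10), ✓p689838) discharged. [cite: Balaban1985BackgroundPropagators, Thm 3.11 p.416, Thm 3.3 p.399, (3.26) p.395, (3.10) p.392] -/
theorem coercive_slots_DeltaEta_of_normG₀ {ε₀ : ℝ} (hε₀ : 0 ≤ ε₀) (U₀ : GaugeField (F.P K) 0 (Matrix.specialUnitaryGroup (Fin 2) ℂ)) (hreg : RegPr F n K ε₀ U₀)
    (Rr : SiteL2K ℂ 3 (periodsT3 F K) c₀ W₂ →ₗ[ℂ] SiteL2K ℂ 3 (periodsT3 F K) c₀ W₂) (hR : Rr.IsSymmetric) (hRR : ∀ u, Rr (Rr u) = Rr u)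
    (Qc : BondL2K ℂ 3 (periodsT3 F K) c₀ W₂ →ₗ[ℂ] CW) {aQ : ℝ} (ha : 0 ≤ aQ) {B₀ : ℝ} (hB₀ : 0 < B₀) (hwin : 1029 * ε₀ * B₀ < 1)
    (G₀ : BondL2K ℂ 3 (periodsT3 F K) c₀ W₂ →ₗ[ℂ] BondL2K ℂ 3 (periodsT3 F K) c₀ W₂)
    (hG : laplaceAK (DeltaEtaSlot F n K c₀ U₀) (DL2 F n K c₀ U₀) Rr (DstarL2 F n K c₀ U₀) Qc (LinearMap.adjoint Qc) ((aQ : ℝ) : ℂ) ∘ₗ G₀ = LinearMap.id)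
    (hGB : ∀ f, ‖G₀ f‖ ≤ B₀ * ‖f‖) (y : BondL2K ℂ 3 (periodsT3 F K) c₀ W₂) :
    B₀⁻¹ * ‖y‖ ^ 2 ≤ RCLike.re ⟪y, laplaceAK (DeltaEtaSlot F n K c₀ U₀) (DL2 F n K c₀ U₀) Rr (DstarL2 F n K c₀ U₀) Qc (LinearMap.adjoint Qc) ((aQ : ℝ) : ℂ) y⟫_ℂ :=
  coercive_slots_of_almostPos_of_inverse_bound F n K c₀ U₀ (DeltaEtaSlot F n K c₀ U₀) (DeltaEta_isSymmetric (F := F) (n := n) (K := K) (c₀ := c₀) U₀) Rr hR hRR Qc ha hB₀ hwin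
    (almostPos_DeltaEtaSlot_of_regPr hε₀ U₀ hreg) G₀ hG hGB y

/-- ★★ **The EX display's `hPosΔ` shape at slot `Δ^η`, any pair**: `0 < re⟪x, Δ_a(U₀) x⟫` for `x ≠ 0`, from the same rows. [cite: Balaban1985BackgroundPropagators, Thm 3.11 p.416] -/
theorem pos_slots_DeltaEta_of_normG₀ {ε₀ : ℝ} (hε₀ : 0 ≤ ε₀) (U₀ : GaugeField (F.P K) 0 (Matrix.specialUnitaryGroup (Fin 2) ℂ)) (hreg : RegPr F n K ε₀ U₀)
    (Rr : SiteL2K ℂ 3 (periodsT3 F K) c₀ W₂ →ₗ[ℂ] SiteL2K ℂ 3 (periodsT3 F K) c₀ W₂) (hR : Rr.IsSymmetric) (hRR : ∀ u, Rr (Rr u) = Rr u)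
    (Qc : BondL2K ℂ 3 (periodsT3 F K) c₀ W₂ →ₗ[ℂ] CW) {aQ : ℝ} (ha : 0 ≤ aQ) {B₀ : ℝ} (hB₀ : 0 < B₀) (hwin : 1029 * ε₀ * B₀ < 1)
    (G₀ : BondL2K ℂ 3 (periodsT3 F K) c₀ W₂ →ₗ[ℂ] BondL2K ℂ 3 (periodsT3 F K) c₀ W₂)
    (hG : laplaceAK (DeltaEtaSlot F n K c₀ U₀) (DL2 F n K c₀ U₀) Rr (DstarL2 F n K c₀ U₀) Qc (LinearMap.adjoint Qc) ((aQ : ℝ) : ℂ) ∘ₗ G₀ = LinearMap.id)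
    (hGB : ∀ f, ‖G₀ f‖ ≤ B₀ * ‖f‖) (x : BondL2K ℂ 3 (periodsT3 F K) c₀ W₂) (hx : x ≠ 0) :
    0 < RCLike.re ⟪x, laplaceAK (DeltaEtaSlot F n K c₀ U₀) (DL2 F n K c₀ U₀) Rr (DstarL2 F n K c₀ U₀) Qc (LinearMap.adjoint Qc) ((aQ : ℝ) : ℂ) x⟫_ℂ := by
  have h1 := coercive_slots_DeltaEta_of_normG₀ F n K c₀ hε₀ U₀ hreg Rr hR hRR Qc ha hB₀ hwin G₀ hG hGB x
  have h2 : 0 < B₀⁻¹ * ‖x‖ ^ 2 := mul_pos (inv_pos.mpr hB₀) (pow_pos (norm_pos_iff.mpr hx) 2)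
  linarith

/-- ★ **THE PROJECTOR SLOT AS PRINT'S `R(U₀) = projR Δs Q′`** (orthogonal projection onto `Δs·ker Q′`, lit ✓`B11Eq103H1Complex.projR` — for ANY `Q′`: the intrinsic `QDS` of the
symmetric letters, or the print-literal comb `Q′combL2` of ★p1 WORD 21 (c)): symmetric and idempotent by ✓`projR_isSymmetric`∕✓`projR_projR`, so only `Q′`, `Qc`, `aQ`, `G₀` remain —
the comb letters' `laplaceAc` bridge instantiates this by `rfl`. [cite: Balaban1985BackgroundPropagators, (3.21)–(3.23) p.394, (3.26) p.395, Thm 3.11 p.416] -/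
theorem coercive_slots_DeltaEta_of_normG₀_projR {ε₀ : ℝ} (hε₀ : 0 ≤ ε₀) (U₀ : GaugeField (F.P K) 0 (Matrix.specialUnitaryGroup (Fin 2) ℂ)) (hreg : RegPr F n K ε₀ U₀)
    {CQ : Type*} [NormedAddCommGroup CQ] [InnerProductSpace ℂ CQ]
    (Δs : SiteL2K ℂ 3 (periodsT3 F K) c₀ W₂ →ₗ[ℂ] SiteL2K ℂ 3 (periodsT3 F K) c₀ W₂) (Q' : SiteL2K ℂ 3 (periodsT3 F K) c₀ W₂ →ₗ[ℂ] CQ)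
    (Qc : BondL2K ℂ 3 (periodsT3 F K) c₀ W₂ →ₗ[ℂ] CW) {aQ : ℝ} (ha : 0 ≤ aQ) {B₀ : ℝ} (hB₀ : 0 < B₀) (hwin : 1029 * ε₀ * B₀ < 1)
    (G₀ : BondL2K ℂ 3 (periodsT3 F K) c₀ W₂ →ₗ[ℂ] BondL2K ℂ 3 (periodsT3 F K) c₀ W₂)
    (hG : laplaceAK (DeltaEtaSlot F n K c₀ U₀) (DL2 F n K c₀ U₀) (projR Δs Q') (DstarL2 F n K c₀ U₀) Qc (LinearMap.adjoint Qc) ((aQ : ℝ) : ℂ) ∘ₗ G₀ = LinearMap.id)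
    (hGB : ∀ f, ‖G₀ f‖ ≤ B₀ * ‖f‖) (y : BondL2K ℂ 3 (periodsT3 F K) c₀ W₂) :
    B₀⁻¹ * ‖y‖ ^ 2 ≤ RCLike.re ⟪y, laplaceAK (DeltaEtaSlot F n K c₀ U₀) (DL2 F n K c₀ U₀) (projR Δs Q') (DstarL2 F n K c₀ U₀) Qc (LinearMap.adjoint Qc) ((aQ : ℝ) : ℂ) y⟫_ℂ :=
  coercive_slots_DeltaEta_of_normG₀ F n K c₀ hε₀ U₀ hreg (projR Δs Q') (projR_isSymmetric Δs Q') (projR_projR Δs Q') Qc ha hB₀ hwin G₀ hG hGB y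


/-! ## v1.1 (w4 g8): the projector corollary with print-literal (non-Hilbert) codomain for `Q′` — seam located by w1 g14 (04:10Z): lit's `projR Δs Q′` needs only
`[AddCommGroup CQ] [Module ℂ CQ]` on `Q′`'s codomain (e.g. the corner-anchored comb block mean `QprimeCombL2` valued in a plain Pi type), not an inner-product space. -/

/-- ★ **THE PROJECTOR SLOT AS `projR Δs Q′` WITH A PLAIN MODULE CODOMAIN FOR `Q′`** — same statement as `coercive_slots_DeltaEta_of_normG₀_projR` with the weaker typeclass assumptions lit's
✓`B11Eq103H1Complex.projR` actually uses; instantiates at `Rr := RcombL2 W = projR (covLapSite W) (QprimeCombL2 W)` by `rfl`. [cite: Balaban1985BackgroundPropagators, (3.21)–(3.23) p.394, Thm 3.11 p.416] -/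
theorem coercive_slots_DeltaEta_of_normG₀_projR' {ε₀ : ℝ} (hε₀ : 0 ≤ ε₀) (U₀ : GaugeField (F.P K) 0 (Matrix.specialUnitaryGroup (Fin 2) ℂ)) (hreg : RegPr F n K ε₀ U₀)
    {CQ : Type*} [AddCommGroup CQ] [Module ℂ CQ]
    (Δs : SiteL2K ℂ 3 (periodsT3 F K) c₀ W₂ →ₗ[ℂ] SiteL2K ℂ 3 (periodsT3 F K) c₀ W₂) (Q' : SiteL2K ℂ 3 (periodsT3 F K) c₀ W₂ →ₗ[ℂ] CQ)
    (Qc : BondL2K ℂ 3 (periodsT3 F K) c₀ W₂ →ₗ[ℂ] CW) {aQ : ℝ} (ha : 0 ≤ aQ) {B₀ : ℝ} (hB₀ : 0 < B₀) (hwin : 1029 * ε₀ * B₀ < 1)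
    (G₀ : BondL2K ℂ 3 (periodsT3 F K) c₀ W₂ →ₗ[ℂ] BondL2K ℂ 3 (periodsT3 F K) c₀ W₂)
    (hG : laplaceAK (DeltaEtaSlot F n K c₀ U₀) (DL2 F n K c₀ U₀) (projR Δs Q') (DstarL2 F n K c₀ U₀) Qc (LinearMap.adjoint Qc) ((aQ : ℝ) : ℂ) ∘ₗ G₀ = LinearMap.id)
    (hGB : ∀ f, ‖G₀ f‖ ≤ B₀ * ‖f‖) (y : BondL2K ℂ 3 (periodsT3 F K) c₀ W₂) :
    B₀⁻¹ * ‖y‖ ^ 2 ≤ RCLike.re ⟪y, laplaceAK (DeltaEtaSlot F n K c₀ U₀) (DL2 F n K c₀ U₀) (projR Δs Q') (DstarL2 F n K c₀ U₀) Qc (LinearMap.adjoint Qc) ((aQ : ℝ) : ℂ) y⟫_ℂ :=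
  coercive_slots_DeltaEta_of_normG₀ F n K c₀ hε₀ U₀ hreg (projR Δs Q') (projR_isSymmetric Δs Q') (projR_projR Δs Q') Qc ha hB₀ hwin G₀ hG hGB y

end Summit.QuantumFields.YangMills.Theorems.Prop7CoerciveSlotsOfNormG0

end
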